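import Summits.Ventures.PercRepro2.CaseOneGadgetUWA1PolyT

/-!
# The gadget `u ~ {w, a₁}`, `w ~ {u, a₂, o, b}` (uwa1): the parts of the T-pair masses
(blind cell PercRepro2, p1 g32; the first stage of the gadget pipeline for the T-forms of the uwa1 gadget)

`sgAT` and `sgATo` are multilinear in the three edge weights `e₀, e₁, e₂` (`u–w`, `u–a₁`, `w–a₂`); their parts
`pgAT_abc` / `pgATo_abc` are polynomials in `e₃, e₄` (`w–o`, `w–b`) and the cells (**`sgAT_parts`**,
**`sgATo_parts`**, the shape of `sgAQ_parts`). Own code; standard axioms. -/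

namespace Summit.Ventures.PercRepro2

namespace CaseOne

section PartsTA5
variable {R : Type*} [CommRing R]

/-- The `e₀^1 e₁^0 e₂^0` part of the mass `T`. -/
def pgAT100 (e₃ e₄ : R) (m : SCells R) : R :=
  (-1 : R) * e₃ * e₄ * m.c8 + (-1 : R) * e₃ * e₄ * m.c7 + (-1 : R) * e₃ * e₄ * m.c5 + (1 : R) * e₃ * m.c8 + (1 : R) * e₃ * m.c7 + (1 : R) * e₃ * m.c6 + (1 : R) * e₄ * m.c8 + (1 : R) * e₄ * m.c5 + (1 : R) * e₄ * m.c2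

/-- The `e₀^1 e₁^0 e₂^1` part of the mass `T`. -/
def pgAT101 (e₃ e₄ : R) (m : SCells R) : R :=
  (1 : R) * e₃ * e₄ * m.c8 + (1 : R) * e₃ * e₄ * m.c7 + (1 : R) * e₃ * e₄ * m.c5 + (1 : R) * e₃ * e₄ * m.c4 + (-1 : R) * e₃ * m.c8 + (-1 : R) * e₃ * m.c7 + (-1 : R) * e₃ * m.c6 + (-1 : R) * e₃ * m.c5 + (-1 : R) * e₃ * m.c4 + (-1 : R) * e₃ * m.c3 + (-1 : R) * e₄ * m.c8 + (-1 : R) * e₄ * m.c7 + (-1 : R) * e₄ * m.c5 + (-1 : R) * e₄ * m.c4 + (-1 : R) * e₄ * m.c2 + (-1 : R) * e₄ * m.c1 + (1 : R) * m.c10 + (1 : R) * m.c9 + (1 : R) * m.c8 + (1 : R) * m.c7 + (1 : R) * m.c6 + (1 : R) * m.c5 + (1 : R) * m.c4 + (1 : R) * m.c3 + (1 : R) * m.c2 + (1 : R) * m.c1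

/-- The `e₀^1 e₁^1 e₂^0` part of the mass `T`. -/
def pgAT110 (e₃ e₄ : R) (m : SCells R) : R :=
  (1 : R) * e₃ * e₄ * m.c8 + (1 : R) * e₃ * e₄ * m.c7 + (1 : R) * e₃ * e₄ * m.c5 + (-1 : R) * e₃ * m.c8 + (-1 : R) * e₃ * m.c7 + (-1 : R) * e₃ * m.c6 + (-1 : R) * e₄ * m.c8 + (-1 : R) * e₄ * m.c5 + (-1 : R) * e₄ * m.c2

/-- The `e₀^1 e₁^1 e₂^1` part of the mass `T`. -/
def pgAT111 (e₃ e₄ : R) (m : SCells R) : R :=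
  (-1 : R) * e₃ * e₄ * m.c8 + (-1 : R) * e₃ * e₄ * m.c7 + (-1 : R) * e₃ * e₄ * m.c5 + (-1 : R) * e₃ * e₄ * m.c4 + (1 : R) * e₃ * m.c8 + (1 : R) * e₃ * m.c7 + (1 : R) * e₃ * m.c6 + (1 : R) * e₃ * m.c5 + (1 : R) * e₃ * m.c4 + (1 : R) * e₃ * m.c3 + (1 : R) * e₄ * m.c8 + (1 : R) * e₄ * m.c7 + (1 : R) * e₄ * m.c5 + (1 : R) * e₄ * m.c4 + (1 : R) * e₄ * m.c2 + (1 : R) * e₄ * m.c1 + (-1 : R) * m.c10 + (-1 : R) * m.c9 + (-1 : R) * m.c8 + (-1 : R) * m.c7 + (-1 : R) * m.c6 + (-1 : R) * m.c5 + (-1 : R) * m.c4 + (-1 : R) * m.c3 + (-1 : R) * m.c2 + (-1 : R) * m.c1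

/-- The mass `T` is multilinear in `e₀, e₁, e₂`: its parts. -/
lemma sgAT_parts (e₀ e₁ e₂ e₃ e₄ : R) (m : SCells R) :
    sgAT e₀ e₁ e₂ e₃ e₄ m = e₀ * pgAT100 e₃ e₄ m + e₀ * e₂ * pgAT101 e₃ e₄ m + e₀ * e₁ * pgAT110 e₃ e₄ m + e₀ * e₁ * e₂ * pgAT111 e₃ e₄ m := by
  unfold sgAT pgAT100 pgAT101 pgAT110 pgAT111
  ring

/-- The `e₀^1 e₁^0 e₂^0` part of the mass `To`. -/
def pgATo100 (e₃ e₄ : R) (m : SCells R) : R :=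
  (-1 : R) * e₃ * e₄ * m.c8 + (-1 : R) * e₃ * e₄ * m.c7 + (-1 : R) * e₃ * e₄ * m.c5 + (1 : R) * e₃ * e₄ * m.c2 + (1 : R) * e₃ * m.c8 + (1 : R) * e₃ * m.c7 + (1 : R) * e₃ * m.c6 + (1 : R) * e₄ * m.c8 + (1 : R) * e₄ * m.c5

/-- The `e₀^1 e₁^0 e₂^1` part of the mass `To`. -/
def pgATo101 (e₃ e₄ : R) (m : SCells R) : R :=
  (-1 : R) * e₃ * e₄ * m.c10 + (1 : R) * e₃ * e₄ * m.c8 + (1 : R) * e₃ * e₄ * m.c7 + (1 : R) * e₃ * e₄ * m.c5 + (1 : R) * e₃ * e₄ * m.c4 + (-1 : R) * e₃ * e₄ * m.c2 + (-1 : R) * e₃ * e₄ * m.c1 + (1 : R) * e₃ * m.c10 + (1 : R) * e₃ * m.c9 + (-1 : R) * e₃ * m.c8 + (-1 : R) * e₃ * m.c7 + (-1 : R) * e₃ * m.c6 + (-1 : R) * e₃ * m.c5 + (-1 : R) * e₃ * m.c4 + (-1 : R) * e₃ * m.c3 + (1 : R) * e₃ * m.c2 + (1 : R) * e₃ * m.c1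 + (1 : R) * e₄ * m.c10 + (-1 : R) * e₄ * m.c8 + (-1 : R) * e₄ * m.c7 + (-1 : R) * e₄ * m.c5 + (-1 : R) * e₄ * m.c4 + (1 : R) * m.c8 + (1 : R) * m.c7 + (1 : R) * m.c6 + (1 : R) * m.c5 + (1 : R) * m.c4 + (1 : R) * m.c3

/-- The `e₀^1 e₁^1 e₂^0` part of the mass `To`. -/
def pgATo110 (e₃ e₄ : R) (m : SCells R) : R :=
  (1 : R) * e₃ * e₄ * m.c8 + (1 : R) * e₃ * e₄ * m.c7 + (1 : R) * e₃ * e₄ * m.c5 + (-1 : R) * e₃ * e₄ * m.c2 + (-1 : R) * e₃ * m.c8 + (-1 : R) * e₃ * m.c7 + (-1 : R) * e₃ * m.c6 + (-1 : R) * e₄ * m.c8 + (-1 : R) * e₄ * m.c5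

/-- The `e₀^1 e₁^1 e₂^1` part of the mass `To`. -/
def pgATo111 (e₃ e₄ : R) (m : SCells R) : R :=
  (1 : R) * e₃ * e₄ * m.c10 + (-1 : R) * e₃ * e₄ * m.c8 + (-1 : R) * e₃ * e₄ * m.c7 + (-1 : R) * e₃ * e₄ * m.c5 + (-1 : R) * e₃ * e₄ * m.c4 + (1 : R) * e₃ * e₄ * m.c2 + (1 : R) * e₃ * e₄ * m.c1 + (-1 : R) * e₃ * m.c10 + (-1 : R) * e₃ * m.c9 + (1 : R) * e₃ * m.c8 + (1 : R) * e₃ * m.c7 + (1 : R) * e₃ * m.c6 + (1 : R) * e₃ * m.c5 + (1 : R) * e₃ * m.c4 + (1 : R) * e₃ * m.c3 + (-1 : R) * e₃ * m.c2 + (-1 : R) * e₃ * m.c1 + (-1 : R) * e₄ * m.c10 + (1 : R) * e₄ * m.c8 + (1 : R) * e₄ * m.c7 + (1 : R) * e₄ * m.c5 + (1 : R) * e₄ * m.c4 + (-1 : R) * m.c8 + (-1 : R) * m.c7 + (-1 : R) * m.c6 + (-1 : R) * m.c5 + (-1 : R) * m.c4 + (-1 : R) * m.c3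

/-- The mass `To` is multilinear in `e₀, e₁, e₂`: its parts. -/
lemma sgATo_parts (e₀ e₁ e₂ e₃ e₄ : R) (m : SCells R) :
    sgATo e₀ e₁ e₂ e₃ e₄ m = e₀ * pgATo100 e₃ e₄ m + e₀ * e₂ * pgATo101 e₃ e₄ m + e₀ * e₁ * pgATo110 e₃ e₄ m + e₀ * e₁ * e₂ * pgATo111 e₃ e₄ m := by
  unfold sgATo pgATo100 pgATo101 pgATo110 pgATo111
  ring

end PartsTA5

end CaseOne

end Summit.Ventures.PercRepro2
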